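import Literature.NumberTheory.EllipticCurves.BSDRootNumberProofs
import Literature.NumberTheory.EllipticCurves.CuspFormLFunctionAtkinLehnerProofs
import Literature.NumberTheory.EllipticCurves.NewformsLevelRaising
import Literature.NumberTheory.EllipticCurves.NewformsOldNewProofs
import HarnessLib

/-!
# Parity of the analytic rank from modularity and the tree's Atkin–Lehner Main Lemma
# `atkinLehnerMainLemma0` (proofs for `BSDRootNumber.lean`, end of chain)

D-0014 keeps `Literature/` sorry-free by stating cited results as named facts `def X : Prop`.
`BSDRootNumberProofs` reduces the parity fact `Literature.NumberTheory.EllipticCurves.even_analyticRank_iff_rootNumber_eq_one`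
(Silverman AEC C.16, Thm. 16.3; Birch–Swinnerton-Dyer 1965, §7) to the Modularity Theorem
`Literature.NumberTheory.EllipticCurves.ModularForms.exists_isNewformOf` and the Atkin–Lehner Main Lemma in weight `2`, the latter
spelled out as a hypothesis
(`even_analyticRank_iff_rootNumber_eq_one_of_exists_isNewformOf_of_mainLemma`). This small file
plugs in the tree's named fact for the Main Lemma, `Literature.ModularForms.atkinLehnerMainLemma0 N k` of
`NewformsLevelRaising` (Atkin–Lehner 1970, Thm. 1; Diamond–Shurman Thm. 5.7.1), through its
corollary `atkinLehnerMainLemma0.mem_oldSubspace0`, and the proved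
`disjoint_oldSubspace0_newSubspace0_holds` of `NewformsOldNewProofs` (`old ∩ new = 0`). It is kept
apart from `BSDRootNumberProofs` so that the latter does not import these two newform files.

* `Literature.NumberTheory.EllipticCurves.ModularForms.IsNewform0.exists_functional_equation_two_of_atkinLehnerMainLemma0`: Hecke's
  functional equation with sign for weight-`2` newforms at every level from
  `∀ N, atkinLehnerMainLemma0 N 2` alone (via `IsNewform0.frickeFacts_of_mainLemma` of
  `CuspFormLFunctionAtkinLehnerProofs`; the concurrently landed sibling `NewformsFrickeSignProofs`
  has the same reduction as `IsNewform0.frickeFacts_of_mainLemma0`).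
* `Literature.NumberTheory.EllipticCurves.even_analyticRank_iff_rootNumber_eq_one_of_exists_isNewformOf_of_atkinLehnerMainLemma0`,
  `WeierstrassCurve.hasFunctionalEquationSign_rootNumber_of_exists_isNewformOf_of_atkinLehnerMainLemma0`:
  **the parity fact and the functional equation of `Λ(E, s)` from exactly two named facts,
  `exists_isNewformOf` (BCDT 2001, Thm. A) and `atkinLehnerMainLemma0 N 2` for all `N`
  (Atkin–Lehner 1970, Thm. 1).** Once `atkinLehnerMainLemma0_holds` lands, modularity is the only
  remaining input.

## References

* A. O. L. Atkin, J. Lehner, *Hecke operators on `Γ₀(m)`*, Math. Ann. 185 (1970), 134–160, Thm. 1,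
  Thm. 3.
* C. Breuil, B. Conrad, F. Diamond, R. Taylor, *On the modularity of elliptic curves over `ℚ`*,
  J. Amer. Math. Soc. 14 (2001), Thm. A.
* J. H. Silverman, *The Arithmetic of Elliptic Curves*, 2nd ed., GTM 106, Springer 2009, C.16,
  Thm. 16.3 and the remark following it (p. 451).
-/

noncomputable section

namespace Literature.NumberTheory.EllipticCurves.ModularForms

open scoped MatrixGroups ModularForm

open CongruenceSubgroup

/-- Weight `2`, all levels: `∀ N, IsNewform0.exists_functional_equation (k := 2)` (the input of
`WeierstrassCurve.exists_hasFunctionalEquationSign_of_modularity`) from the tree's Main Lemma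
`∀ N, atkinLehnerMainLemma0 N 2` (Atkin–Lehner 1970, Thm. 1 ⇒ Thm. 3 ⇒ Hecke's functional equation
with sign), through `IsNewform0.frickeFacts_of_mainLemma` of `CuspFormLFunctionAtkinLehnerProofs`
fed with `atkinLehnerMainLemma0.mem_oldSubspace0` (`NewformsLevelRaising`) and
`disjoint_oldSubspace0_newSubspace0_holds` (`NewformsOldNewProofs`). (The sibling
`NewformsFrickeSignProofs`, landed concurrently, proves the same bundle as
`IsNewform0.frickeFacts_of_mainLemma0`.) [cite: AtkinLehner1970, Thm. 1 and Thm. 3] -/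
theorem IsNewform0.exists_functional_equation_two_of_atkinLehnerMainLemma0
    (hML : ∀ (N : ℕ) [NeZero N], atkinLehnerMainLemma0 N 2) (N : ℕ) [NeZero N] :
    IsNewform0.exists_functional_equation (N := N) (k := 2) :=
  (IsNewform0.frickeFacts_of_mainLemma N 2 (fun h hh ↦ (hML N).mem_oldSubspace0 N 2 h hh)
    (disjoint_oldSubspace0_newSubspace0_holds N 2)).2.2.2

end Literature.NumberTheory.EllipticCurves.ModularForms

namespace Literature.NumberTheory.EllipticCurves

/-- **bsd.S36, parity consequence, from modularity and the Atkin–Lehner Main Lemma (tree's named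
fact).** The fact `even_analyticRank_iff_rootNumber_eq_one W` — `ord_{s=1} L(E, s)` is even iff
`w(E) = 1` (Silverman AEC C.16, Thm. 16.3 and remark, p. 451; Birch–Swinnerton-Dyer 1965, §7) —
from exactly two named facts: the Modularity Theorem `Literature.NumberTheory.EllipticCurves.ModularForms.exists_isNewformOf`
(Breuil–Conrad–Diamond–Taylor 2001, Thm. A) and the Atkin–Lehner Main Lemma
`Literature.ModularForms.atkinLehnerMainLemma0 N 2` for all levels `N` (Atkin–Lehner 1970, Thm. 1).
[cite: SilvermanAEC2009, C.16 Thm. 16.3 and remark, p. 451] [cite: BCDTJAMS2001, Thm. A]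
[cite: AtkinLehner1970, Thm. 1] -/
theorem even_analyticRank_iff_rootNumber_eq_one_of_exists_isNewformOf_of_atkinLehnerMainLemma0
    (W : WeierstrassCurve ℚ) (hmod : Literature.NumberTheory.EllipticCurves.ModularForms.exists_isNewformOf)
    (hML : ∀ (N : ℕ) [NeZero N], Literature.NumberTheory.EllipticCurves.ModularForms.atkinLehnerMainLemma0 N 2) :
    even_analyticRank_iff_rootNumber_eq_one W :=
  even_analyticRank_iff_rootNumber_eq_one_of_modularity W hmod
    (Literature.NumberTheory.EllipticCurves.ModularForms.IsNewform0.exists_functional_equation_two_of_atkinLehnerMainLemma0 hML)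

/-- The prelude fact `WeierstrassCurve.hasFunctionalEquationSign_rootNumber` (functional equation
of `Λ(E, s)` with sign `w(E) = ±1`) from modularity and the Atkin–Lehner Main Lemma.
[cite: BCDTJAMS2001, Thm. A] [cite: AtkinLehner1970, Thm. 1] -/
theorem _root_.WeierstrassCurve.hasFunctionalEquationSign_rootNumber_of_exists_isNewformOf_of_atkinLehnerMainLemma0
    (W : WeierstrassCurve ℚ) (hmod : Literature.NumberTheory.EllipticCurves.ModularForms.exists_isNewformOf)
    (hML : ∀ (N : ℕ) [NeZero N], Literature.NumberTheory.EllipticCurves.ModularForms.atkinLehnerMainLemma0 N 2) :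
    W.hasFunctionalEquationSign_rootNumber :=
  W.hasFunctionalEquationSign_rootNumber_of_exists_isNewformOf hmod
    (Literature.NumberTheory.EllipticCurves.ModularForms.IsNewform0.exists_functional_equation_two_of_atkinLehnerMainLemma0 hML)

/-- bsd.S08 `completedLFunction_functional_equation W` from modularity and the Atkin–Lehner Main
Lemma. [cite: BCDTJAMS2001, Thm. A] [cite: AtkinLehner1970, Thm. 1] -/
theorem completedLFunction_functional_equation_of_exists_isNewformOf_of_atkinLehnerMainLemma0
    (W : WeierstrassCurve ℚ) (hmod : Literature.NumberTheory.EllipticCurves.ModularForms.exists_isNewformOf)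
    (hML : ∀ (N : ℕ) [NeZero N], Literature.NumberTheory.EllipticCurves.ModularForms.atkinLehnerMainLemma0 N 2) :
    completedLFunction_functional_equation W :=
  completedLFunction_functional_equation_of_modularity W hmod
    (Literature.NumberTheory.EllipticCurves.ModularForms.IsNewform0.exists_functional_equation_two_of_atkinLehnerMainLemma0 hML)

end Literature.NumberTheory.EllipticCurves

end
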